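/-
Copyright (c) 2026. All rights reserved.
Released under Apache 2.0 license as described in the file LICENSE.
-/
import Mathlib
import Summits.RiemannHypothesis.RiemannHypothesis.Theorems.HandoffLatticeUncertainty
import HarnessLib

/-!
# The lattice tail is a functional of the a.e.-class of the datum

`HANDOFF/prove-1` gen15, ATTEMPT-22 (S22-h). The dilation sum `θ_F(u) = Σ_{n ≤ λ/u} F(nu)`
samples `F` at points, yet it depends only on the a.e.-class of `F`: if `F = G` a.e. then
`θ_F = θ_G` a.e. (`dilationSum_ae_congr`: the exceptional set is `⋃_{n ≥ 1} n⁻¹·{F ≠ G}`, a countable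
union of null sets) and hence `latticeTail λ F = latticeTail λ G` (`latticeTail_congr_ae`). This
is what lets the L²-side of the track (slaved completions, L-EL: `HandoffSlavedEL`, whose
conclusions hold a.e.) talk to the pointwise lattice-tail theorems (`HandoffLatticeTailDepth`,
`…Jump`); `leakage_congr_ae` records the same for the leakage. RH-free; nothing here bears on the
truth of RH.
-/

set_option linter.dupNamespace false

noncomputable section

open MeasureTheory Set
open scoped FourierTransform

namespace Summit.RiemannHypothesis.RiemannHypothesis.Theorems

namespace LatticeUncertainty

/-- If `F = G` a.e. then, for a.e. `u`, `F (n u) = G (n u)` for EVERY `n ≥ 1` simultaneously. -/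
theorem ae_forall_mul_eq_of_ae_eq {F G : ℝ → ℂ} (h : F =ᵐ[volume] G) :
    ∀ᵐ u ∂(volume : Measure ℝ), ∀ n : ℕ, 1 ≤ n → F (n * u) = G (n * u) := by
  have hN : volume {x : ℝ | F x ≠ G x} = 0 := by
    have := h
    rw [Filter.EventuallyEq, ae_iff] at this
    simpa using this
  have hbad : ∀ n : ℕ, 1 ≤ n → volume (((n : ℝ) * ·) ⁻¹' {x : ℝ | F x ≠ G x}) = 0 := by
    intro n hn
    have hn0 : (n : ℝ) ≠ 0 := by exact_mod_cast (Nat.one_le_iff_ne_zero.mp hn)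
    rw [Real.volume_preimage_mul_left hn0, hN, mul_zero]
  have hU : volume (⋃ n : ℕ, ((((n + 1 : ℕ) : ℝ) * ·) ⁻¹' {x : ℝ | F x ≠ G x})) = 0 :=
    measure_iUnion_null fun n ↦ hbad (n + 1) (Nat.succ_le_succ (Nat.zero_le _))
  rw [ae_iff]
  refine measure_mono_null (fun u hu ↦ ?_) hU
  simp only [mem_setOf_eq, not_forall] at hu
  obtain ⟨n, hn, hne⟩ := hu
  refine mem_iUnion.mpr ⟨n - 1, ?_⟩
  have : n - 1 + 1 = n := Nat.sub_add_cancel hn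
  rw [this]
  exact hne

/-- **`θ_F` depends only on the a.e.-class of `F`.** -/
theorem dilationSum_ae_congr (lam : ℝ) {F G : ℝ → ℂ} (h : F =ᵐ[volume] G) :
    ∀ᵐ u ∂(volume : Measure ℝ), dilationSum lam F u = dilationSum lam G u := by
  filter_upwards [ae_forall_mul_eq_of_ae_eq h] with u hu
  unfold dilationSum
  exact Finset.sum_congr rfl fun n hn ↦ hu n (Finset.mem_Icc.mp hn).1

/-- **The lattice tail is a functional of the a.e.-class**: `F = G` a.e. implies
`latticeTail λ F = latticeTail λ G`. -/
theorem latticeTail_congr_ae (lam : ℝ) {F G : ℝ → ℂ} (h : F =ᵐ[volume] G) :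
    latticeTail lam F = latticeTail lam G := by
  unfold latticeTail
  refine integral_congr_ae (ae_restrict_of_ae ?_)
  filter_upwards [dilationSum_ae_congr lam h] with u hu
  rw [hu]

/-- The leakage, too, is a functional of the a.e.-class (`𝓕` is: Mathlib `Real.fourier_congr_ae`). -/
theorem leakage_congr_ae (lam : ℝ) {F G : ℝ → ℂ} (h : F =ᵐ[volume] G) :
    leakage lam F = leakage lam G := by
  unfold leakage
  refine integral_congr_ae (ae_of_all _ fun ξ ↦ ?_)
  simp only
  rw [Real.fourier_congr_ae h]

end LatticeUncertainty

end Summit.RiemannHypothesis.RiemannHypothesis.Theorems
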